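/-
Copyright (c) 2026. All rights reserved.
Released under Apache 2.0 license as described in the file LICENSE.
Authors: HodgeCM publication cell (pub-hodgecm), GR lane, seat GR-2 (`pub-hodgecm-own-hyp34`).
-/
import Literature.NumberTheory.Weil1964.ArchComplexPlacesSection
import Literature.NumberTheory.Weil1964.ArchMetaplecticQuotientCharacter
import Literature.NumberTheory.Weil1964.ArchMetaplecticTensor
import Mathlib.RingTheory.Complex
import Mathlib.RingTheory.Norm.Transitivity
import HarnessLib

/-!
# Folland's quotient character on the Levi sections over the complex places (`= 1`) and on tensor products

Topic `NumberTheory/Weil1964`; namespace `Literature.NumberTheory.Weil1964`.  KERNEL ONLY: theorems (and one linear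
equivalence with body); no `def … : Prop` record, no axiom, no proof hole.

Folland's quotient character `quot : Mp^𝓢(W) → S¹` (`ArchMetaplecticQuotientCharacter`; kernel `Mp₂(W)`) measures how
far a metaplectic element is from the `det^{1/2}`-normalisation; it enters the Siegel-parabolic normalisation of the
archimedean Weil section through the twist condition `η(g)² · quot(s(g)) = χ(det_Δ)²`
(`GRConstructionGen.isArchHalf_twist_archLift`).  Here:

* §1 `det (Res M) = |det M|²` for the realification `resMat` of a complex matrix (`det_resMat`, via
  `LinearMap.det_restrictScalars` and `Algebra.norm ℝ (z : ℂ) = |z|²`), so `det (Res g) > 0` on `GL_ι(ℂ)`;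
* §2 `quot (leviGL a) = 1` for `det a > 0` and hence **`quot (placeLeviSection x A g) = 1`** whenever every slice
  `A g v` has positive determinant (`quot` is conjugation invariant) — in particular **`quot (cxPlacesSection x g) = 1`**:
  the complex places of `F` contribute nothing to the quotient character;
* §3 **`quot (x₁ ⊠ x₂) = quot x₁ · quot x₂`** (`MpS.quot_tensor`; `vac_tensor` and `det P(g₁ ⊕ g₂) = det P(g₁) det P(g₂)`).

[Folland1989, §4.2 (4.24), Thm. (4.37), Prop. (1.43)]; [Adams2007, §5 Rem. 5.6] (the `det^{1/2}` phenomenon);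
[MoeglinVignerasWaldspurger1987, Chap. 2 II.1 (6)].

## References
* [Folland1989] G. B. Folland, *Harmonic Analysis in Phase Space*, Princeton UP 1989, §4.2 (4.24), Thm. (4.37).
* [Adams2007] J. Adams, *The theta correspondence over ℝ*, in: Harmonic analysis, group representations, automorphic
  forms and invariant theory, World Scientific 2007, §5 Rem. 5.6.
* [MoeglinVignerasWaldspurger1987] C. Mœglin, M.-F. Vignéras, J.-L. Waldspurger, LNM 1291 (1987), Chap. 2 II.1 (6).
-/

set_option autoImplicit false

noncomputable section

open scoped Matrix ComplexConjugate Classical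
open Matrix NumberField NumberField.InfinitePlace NumberField.mixedEmbedding
open Literature.RepresentationTheory.HeisenbergGroup
open Literature.RepresentationTheory.HeisenbergGroup.SymplecticMatrix
open Literature.Analysis.SegalBargmann
open Literature.NumberTheory.Automorphic Literature.NumberTheory.Automorphic.UnitaryGroup
open Literature.RepresentationTheory.KonnoKonno2007

namespace Literature.NumberTheory.Weil1964

/-! ## §1 `det (Res M) = |det M|²` -/

section Det

variable {ι : Type} [Fintype ι] [DecidableEq ι]

variable (ι) in
/-- `reImVec` as a real-linear isomorphism `ℂ^ι ≃ₗ[ℝ] ℝ^{ι ⊕ ι}`. [cite: Folland1989, Ch. 4 §1 Prop. (4.6)] -/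
def reImLinearEquiv : (ι → ℂ) ≃ₗ[ℝ] (ι ⊕ ι → ℝ) where
  toFun := reImVec ι
  invFun := ofReImVec ι
  map_add' := reImVec_add
  map_smul' c z := reImVec_smul c z
  left_inv := ofReImVec_reImVec
  right_inv := reImVec_ofReImVec

omit [Fintype ι] [DecidableEq ι] in
/-- unfolding. [cite: Folland1989, Ch. 4 §1 Prop. (4.6)] -/
@[simp] theorem reImLinearEquiv_apply (z : ι → ℂ) : reImLinearEquiv ι z = reImVec ι z := rfl

omit [Fintype ι] [DecidableEq ι] in
/-- unfolding of the inverse. [cite: Folland1989, Ch. 4 §1 Prop. (4.6)] -/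
@[simp] theorem reImLinearEquiv_symm_apply (p : ι ⊕ ι → ℝ) : (reImLinearEquiv ι).symm p = ofReImVec ι p := rfl

/-- `resMat M` is the matrix of `z ↦ M z` restricted to real scalars, in the frame `reImVec`.
[cite: Folland1989, Ch. 4 §1 Prop. (4.6)] -/
theorem toLin'_resMat (M : Matrix ι ι ℂ) :
    Matrix.toLin' (resMat ι M) =
      ((reImLinearEquiv ι : (ι → ℂ) ≃ₗ[ℝ] (ι ⊕ ι → ℝ)) : (ι → ℂ) →ₗ[ℝ] (ι ⊕ ι → ℝ)) ∘ₗ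
        ((Matrix.toLin' M).restrictScalars ℝ) ∘ₗ
          (((reImLinearEquiv ι).symm : (ι ⊕ ι → ℝ) ≃ₗ[ℝ] (ι → ℂ)) : (ι ⊕ ι → ℝ) →ₗ[ℝ] (ι → ℂ)) := by
  refine LinearMap.ext fun p => ?_
  rw [Matrix.toLin'_apply, LinearMap.comp_apply, LinearMap.comp_apply, LinearEquiv.coe_coe, LinearEquiv.coe_coe,
    LinearMap.restrictScalars_apply, Matrix.toLin'_apply, reImLinearEquiv_symm_apply, reImLinearEquiv_apply,
    reImVec_mulVec, reImVec_ofReImVec]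

/-- **`det (Res M) = |det M|²`.** [cite: Folland1989, Ch. 4 §1 Prop. (4.6)] -/
theorem det_resMat (M : Matrix ι ι ℂ) : (resMat ι M).det = Complex.normSq M.det := by
  rw [← LinearMap.det_toLin', toLin'_resMat, LinearMap.det_conj ((Matrix.toLin' M).restrictScalars ℝ) (reImLinearEquiv ι),
    LinearMap.det_restrictScalars, LinearMap.det_toLin', Algebra.norm_complex_apply]

/-- **`det (Res g) > 0`** on `GL_ι(ℂ)`. [cite: Folland1989, Ch. 4 §1 Prop. (4.6)] -/
theorem det_resGL_pos (g : GL ι ℂ) : 0 < ((resGL ι g : GL (ι ⊕ ι) ℝ) : Matrix (ι ⊕ ι) (ι ⊕ ι) ℝ).det := by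
  rw [coe_resGL, det_resMat]
  exact Complex.normSq_pos.2 (g.isUnit.map Matrix.detMonoidHom).ne_zero

end Det

/-! ## §2 `quot = 1` on Levi sections with positive determinants -/

section Levi

variable {σ : Type*} [Fintype σ] [DecidableEq σ]

/-- the linear map of `glEquiv a` is `toLin' a`. [cite: Folland1989, §4.2 (4.24)] -/
theorem coe_glEquiv_eq_toLin' (a : GL σ ℝ) : ((glEquiv a : (σ → ℝ) ≃ₗ[ℝ] (σ → ℝ)) : (σ → ℝ) →ₗ[ℝ] (σ → ℝ)) = Matrix.toLin' (a : Matrix σ σ ℝ) :=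
  LinearMap.ext fun x => by rw [LinearEquiv.coe_coe, glEquiv_apply, Matrix.toLin'_apply]

/-- **`quot (leviGL a) = 1` for `det a > 0`** (Folland's Levi element `|det a|^{-1/2} f(a⁻¹ x)` is metaplectic).
[cite: Folland1989, §4.2 (4.24), Thm. (4.37)] -/
theorem MpS.quot_leviGL_of_det_pos (a : GL σ ℝ) (ha : 0 < (a : Matrix σ σ ℝ).det) : MpS.quot (MpS.leviGL a) = 1 := by
  refine MpS.quot_levi_of_det_pos (glEquiv a) (glEquiv (trInv a)) (dotPairing_glEquiv_trInv a) ?_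
  rw [coe_glEquiv_eq_toLin', LinearMap.det_toLin']
  exact ha

variable {m : Type} [Fintype m] [DecidableEq m] {o : Type} [Fintype o] [DecidableEq o] {G : Type*} [Group G]

/-- **`quot (placeLeviSection x A g) = 1`** when every slice `A g v` has positive determinant: `quot` is conjugation
invariant and the block-diagonal Levi has `det = ∏_v det (A g v) > 0`. [cite: Folland1989, §4.2 Thm. (4.37)] -/
theorem quot_placeLeviSection (A : G →* (o → GL m ℝ)) (x : MpS (m × o))
    (hA : ∀ g v, 0 < ((A g v : GL m ℝ) : Matrix m m ℝ).det) (g : G) :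
    MpS.quot (placeLeviSection m o A x g) = 1 := by
  rw [placeLeviSection_apply, MpS.quot_conj]
  refine MpS.quot_leviGL_of_det_pos _ ?_
  rw [GL.coe_placeDiag, Matrix.det_blockDiagonal]
  exact Finset.prod_pos fun v _ => hA g v

end Levi

/-! ## §3 The complex places contribute nothing: `quot (cxPlacesSection x g) = 1` -/

section Complex

variable (F : Type) [Field F] [NumberField F] (E : Type) [Field E] [NumberField E] [Algebra F E] (c : E ≃ₐ[F] E)
  (hcc : c * c = 1) (N : ℕ) (T₀ : Matrix (Fin N) (Fin N) F)
  {J : Matrix (Fin N) (Fin N) E} (hJ : J = T₀.map (algebraMap F E)) {δ : E} (hδ : δ ≠ 0)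
  (wOf : {v : InfinitePlace F // v.IsComplex} → {w : InfinitePlace E // w.IsComplex})

omit [NumberField F] [NumberField E] in
/-- every slice of the Levi family has positive determinant: `det (Res g_{w(v)}) = |det g_{w(v)}|² > 0`.
[cite: Folland1989, Ch. 4 §1 Prop. (4.6)] -/
theorem det_cxLeviFamily_pos (g : UnitaryGroup.arch F E c N J) (v : {v : InfinitePlace F // v.IsComplex}) :
    0 < ((cxLeviFamily F E c hcc N T₀ hJ hδ wOf g v : GL (Fin N ⊕ Fin N) ℝ) : Matrix (Fin N ⊕ Fin N) (Fin N ⊕ Fin N) ℝ).det := by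
  rw [cxLeviFamily_apply]
  exact det_resGL_pos _

omit [NumberField E] in
/-- **`quot (cxPlacesSection x g) = 1`**: the complex places of `F` contribute nothing to Folland's quotient character
of the archimedean Weil section. [cite: Folland1989, §4.2 Thm. (4.37); MoeglinVignerasWaldspurger1987, Chap. 2 II.2] -/
theorem quot_cxPlacesSection (x : MpS ((Fin N ⊕ Fin N) × {v : InfinitePlace F // v.IsComplex}))
    (g : UnitaryGroup.arch F E c N J) :
    MpS.quot (cxPlacesSection F E c hcc N T₀ hJ hδ wOf x g) = 1 :=
  quot_placeLeviSection _ x (det_cxLeviFamily_pos F E c hcc N T₀ hJ hδ wOf) g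

end Complex

/-! ## §4 `quot` is multiplicative on tensor products -/

section Tensor

variable {σ₁ σ₂ : Type} [Fintype σ₁] [DecidableEq σ₁] [Fintype σ₂] [DecidableEq σ₂]

/-- **`quot (x₁ ⊠ x₂) = quot x₁ · quot x₂`**: the vacuum coefficient and `det P` are both multiplicative over block sums.
[cite: Folland1989, Prop. (1.43), §4.2 (4.36); MoeglinVignerasWaldspurger1987, Chap. 2 II.1 (6)] -/
theorem MpS.quot_tensor (x₁ : MpS σ₁) (x₂ : MpS σ₂) : MpS.quot (MpS.tensor x₁ x₂) = MpS.quot x₁ * MpS.quot x₂ := by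
  rw [MpS.quot, MpS.quot, MpS.quot, MpS.vac_tensor, MpS.proj_tensor, Sp.det_follandP_spBlock]
  ring

end Tensor

end Literature.NumberTheory.Weil1964

end
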